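import Summits.HodgeConjecture.HodgeConjecture.Theorems.PadicSemiregularLiftHodgeFermatVarietiesPairedOfLargePrimesSharp
import Summits.HodgeConjecture.HodgeConjecture.Theorems.PadicSemiregularLiftHodgeFermatVarietiesFibreOfBoundaryNat
import HarnessLib

/-!
# The level analysis at a level with one small prime, for Hodge characters of EVERY length — line `cancel-by-any-claim-lattice`, crux `HodgeFermatVarieties` (stmt-HodgeConjecture-1334)

Lead c4's programme GS (single-small-prime levels, all lengths, reachability by induction on the length), stub GS-L2a
`stub_fibre_of_top_level_single`. Setting: a prime `p₁ ≥ 5`, a level `m` prime to `6` with `p₁² ∤ m` whose prime factors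
OTHER than `p₁` are all `≥ R + 3`, a Hodge character `α : Fin R → ℤ/m` of ANY length `R`, and a level `M ∣ m` whose
unit-part multiplicity function is not even while those of all proper multiples of `M` are. THEOREM: `M = p₁ n` with
`p₁ ∤ n`, `n > 1`, and a full fibre `{crt⁻¹(y, b) : y ∈ (ℤ/p₁)ˣ}` consists of unit parts of level-`M` entries of `α`.
(Aoki's criterion at conductor `M` + evenness above make `T = cnt_M` orthogonal to the odd primitive characters; the refined
counting `even_of_oddNull'` can fail only at a prime `q ≤ #supp T + 1 ≤ R + 1`, i.e. at `q = p₁`; then `M = p₁ n`,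
`p₁ ∤ n`, every prime of `n` is `≥ R + 3 > #supp T + 1`, and the ℕ-valued dichotomy `stub_fibre_of_boundary_nat` gives the
fibre.) This is the length-free engine behind the induction "non-paired ⟹ juxtapose with `σ_{p₁,-A}` ⟹ shorter".

References: [Aoki1983] N. Aoki, Math. Ann. 266 (1983) 23–54, Thm. A′ (§7), Prop. 2.2, Prop. 6.4.
-/

-- every sibling file of the line declares into `…CancelByAnyClaimLattice.PairedNull` from a differently named module
set_option linter.dupNamespace false

noncomputable section

open Finset
open Literature.AlgebraicGeometry.HodgeTheory Literature.AlgebraicGeometry.HodgeTheory.FermatCharacter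

namespace Summit.HodgeConjecture.HodgeConjecture.Theorems.CancelByAnyClaimLattice

namespace PairedNull

section TopLevelSingle

variable {m : ℕ} [NeZero m] {R : ℕ} {α : Fin R → ZMod m}

/-- **The level analysis at a level with ONE small prime** (section-variable form; see the module docstring): the
failing prime of the refined counting is forced to be `p₁`, and the ℕ-valued dichotomy gives a full `p₁`-fibre.
[cite: Aoki1983, Thm. A′ (§7), Prop. 2.2, Prop. 6.4] -/
theorem fibre_of_top_level_single {p₁ : ℕ} (hp₁ : p₁.Prime) (hp₁5 : 5 ≤ p₁) (hm6 : m.Coprime 6)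
    (hbig : ∀ q ∈ m.primeFactors, q ≠ p₁ → R + 3 ≤ q) (hsq : ¬ p₁ * p₁ ∣ m) (h : IsHodge α)
    {M : ℕ} (hMm : M ∣ m)
    (hne : ∃ v : ZMod M,
      #(univ.filter fun i : Fin R ↦ m / m.gcd (α i).val = M ∧ ((((α i).val / (m / M)) : ℕ) : ZMod M) = -v) ≠
      #(univ.filter fun i : Fin R ↦ m / m.gcd (α i).val = M ∧ ((((α i).val / (m / M)) : ℕ) : ZMod M) = v))
    (hIH : ∀ M' : ℕ, M' ∣ m → M ∣ M' → M' ≠ M → ∀ u : ZMod M',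
      #(univ.filter fun i : Fin R ↦ m / m.gcd (α i).val = M' ∧ ((((α i).val / (m / M')) : ℕ) : ZMod M') = -u) =
      #(univ.filter fun i : Fin R ↦ m / m.gcd (α i).val = M' ∧ ((((α i).val / (m / M')) : ℕ) : ZMod M') = u)) :
    ∃ (n : ℕ) (hc : Nat.Coprime p₁ n), M = p₁ * n ∧ 1 < n ∧ ∃ b : ZMod n, IsUnit b ∧
      ∀ y : (ZMod p₁)ˣ, ∃ i : Fin R, m / m.gcd (α i).val = p₁ * n ∧
        ((((α i).val / (m / (p₁ * n))) : ℕ) : ZMod (p₁ * n)) = (ZMod.chineseRemainder hc).symm ((y : ZMod p₁), b) := by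
  classical
  haveI : NeZero p₁ := ⟨hp₁.ne_zero⟩
  have hm0 : m ≠ 0 := NeZero.ne m
  have hM0 : M ≠ 0 := fun h0 ↦ hm0 (by rw [h0] at hMm; exact zero_dvd_iff.mp hMm)
  haveI : NeZero M := ⟨hM0⟩
  -- the multiplicity function of the level-`M` unit parts
  set cnt : ZMod M → ℕ := fun u ↦
    #(univ.filter fun i : Fin R ↦ m / m.gcd (α i).val = M ∧ ((((α i).val / (m / M)) : ℕ) : ZMod M) = u) with hcnt
  set T : ZMod M → ℂ := fun u ↦ (cnt u : ℂ) with hT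
  have hTnat : ∀ u, ∃ k : ℕ, T u = k := fun u ↦ ⟨cnt u, rfl⟩
  have hnotev : ¬ ∀ u, T (-u) = T u := by
    intro hev
    obtain ⟨v, hv⟩ := hne
    apply hv
    have := hev v
    simp only [hT, Nat.cast_inj] at this
    exact this
  have hspec : ∀ i, IsUnit ((((α i).val / (m / (m / m.gcd (α i).val)) : ℕ) : ZMod (m / m.gcd (α i).val))) ∧
      ((m / (m / m.gcd (α i).val) : ℕ) : ZMod m) *
        ((ZMod.val ((((α i).val / (m / (m / m.gcd (α i).val)) : ℕ) : ZMod (m / m.gcd (α i).val))) : ℕ) : ZMod m)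
          = α i :=
    fun i ↦ unitPart_spec (α i)
  have hcastM : ∀ (L : ℕ) (_ : L = M) (y : ZMod m),
      (ZMod.cast ((((y.val / (m / L)) : ℕ) : ZMod L)) : ZMod M) = (((y.val / (m / M)) : ℕ) : ZMod M) := by
    intro L hL y; subst hL; exact ZMod.cast_id _ _
  have hcast : ∀ (L M' : ℕ) (_ : L = M') (hMM' : M ∣ M') (y : ZMod m),
      (ZMod.cast ((((y.val / (m / L)) : ℕ) : ZMod L)) : ZMod M) =
        ZMod.castHom hMM' (ZMod M) ((((y.val / (m / M')) : ℕ) : ZMod M')) := by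
    intro L M' hL hMM' y; subst hL; rfl
  have hTu : ∀ u, ¬ IsUnit u → T u = 0 := by
    intro u hu
    simp only [hT, Nat.cast_eq_zero, hcnt, Finset.card_eq_zero, Finset.filter_eq_empty_iff]
    intro i _ hi
    apply hu
    have hdvd : M ∣ m / m.gcd (α i).val := by rw [hi.1]
    rw [← hi.2, ← hcastM _ hi.1 (α i)]
    exact ((hspec i).1).map (ZMod.castHom hdvd (ZMod M))
  set I : Finset (Fin R) := univ.filter fun i : Fin R ↦ m / m.gcd (α i).val = M with hI
  have hsupp_img : (univ.filter fun u : ZMod M ↦ T u ≠ 0) =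
      I.image fun i ↦ ((((α i).val / (m / M)) : ℕ) : ZMod M) := by
    ext u
    rw [mem_filter, mem_image]
    simp only [mem_univ, true_and, hT, Nat.cast_ne_zero, hcnt]
    rw [Finset.card_ne_zero]
    constructor
    · rintro ⟨i, hi⟩
      rw [mem_filter] at hi
      exact ⟨i, by rw [hI, mem_filter]; exact ⟨mem_univ _, hi.2.1⟩, hi.2.2⟩
    · rintro ⟨i, hi, hiu⟩
      rw [hI, mem_filter] at hi
      exact ⟨i, by rw [mem_filter]; exact ⟨mem_univ _, hi.2, hiu⟩⟩
  have hsuppR : #(univ.filter fun u : ZMod M ↦ T u ≠ 0) ≤ R := by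
    rw [hsupp_img]
    exact card_image_le.trans ((card_le_univ I).trans (by rw [Fintype.card_fin]))
  -- every prime of `m` (hence of `M`) is at least `5`, and the primes other than `p₁` are `≥ R + 3`
  have hMm' : ∀ p ∈ M.primeFactors, p ∈ m.primeFactors := fun p hp ↦ Nat.mem_primeFactors.mpr
    ⟨Nat.prime_of_mem_primeFactors hp, (Nat.dvd_of_mem_primeFactors hp).trans hMm, hm0⟩
  have hMbig : ∀ p ∈ M.primeFactors, p ≠ p₁ → R + 3 ≤ p := fun p hp hne' ↦ hbig p (hMm' p hp) hne'
  have hM5 : ∀ p ∈ M.primeFactors, 5 ≤ p := by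
    intro p hp
    have hpP := Nat.prime_of_mem_primeFactors hp
    have hpm := Nat.dvd_of_mem_primeFactors (hMm' p hp)
    have h2 : p ≠ 2 := by
      rintro rfl; exact absurd (Nat.Coprime.coprime_dvd_left hpm hm6) (by norm_num)
    have h3 : p ≠ 3 := by
      rintro rfl; exact absurd (Nat.Coprime.coprime_dvd_left hpm hm6) (by norm_num)
    have h4 : p ≠ 4 := by rintro rfl; exact absurd hpP (by decide)
    have := hpP.two_le
    omega
  haveI : ∀ i, NeZero (m / m.gcd (α i).val) := fun i ↦ ⟨(level_pos (α i)).ne'⟩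
  -- Aoki's criterion at conductor `M`: `T` is orthogonal to the odd primitive characters mod `M`
  have hTodd : ∀ χ : DirichletCharacter ℂ M, χ.Odd → χ.IsPrimitive → ∑ u : ZMod M, T u * χ u = 0 := by
    intro χ hχ hprim
    have key := h.aoki_criterion hMm hχ hprim (fun i ↦ m / m.gcd (α i).val) (fun i ↦ level_dvd (α i))
      (fun i ↦ ((((α i).val / (m / (m / m.gcd (α i).val)) : ℕ) : ZMod (m / m.gcd (α i).val))))
      (fun i ↦ (hspec i).1) (fun i ↦ (hspec i).2.symm)
    have hone : (∏ p ∈ M.primeFactors, (1 - χ p)) = 1 := by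
      refine Finset.prod_eq_one fun p hp ↦ ?_
      have hnu : ¬ IsUnit ((p : ℕ) : ZMod M) := by
        rw [ZMod.isUnit_iff_coprime]
        exact fun hc ↦ (Nat.prime_of_mem_primeFactors hp).one_lt.ne'
          (Nat.Coprime.eq_one_of_dvd hc (Nat.dvd_of_mem_primeFactors hp))
      rw [χ.map_nonunit hnu, sub_zero]
    have hA : (fun L : ℕ ↦ ((m.totient : ℂ) / (L.totient : ℂ)) * ∏ p ∈ L.primeFactors, (1 - χ p)) M ≠ 0 := by
      show ((m.totient : ℂ) / (M.totient : ℂ)) * ∏ p ∈ M.primeFactors, (1 - χ p) ≠ 0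
      rw [hone, mul_one]
      exact div_ne_zero (by exact_mod_cast (Nat.totient_pos.mpr (NeZero.pos m)).ne')
        (by exact_mod_cast (Nat.totient_pos.mpr (NeZero.pos M)).ne')
    have key' := sum_level_eq_zero_of_criterion χ hχ (fun i ↦ m / m.gcd (α i).val)
      (fun i ↦ (level_pos (α i)).ne')
      (fun i ↦ ((((α i).val / (m / (m / m.gcd (α i).val)) : ℕ) : ZMod (m / m.gcd (α i).val))))
      (fun L : ℕ ↦ ((m.totient : ℂ) / (L.totient : ℂ)) * ∏ p ∈ L.primeFactors, (1 - χ p)) hA key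
      (fun i ↦ ((((α i).val / (m / M)) : ℕ) : ZMod M)) (fun i hi ↦ hcastM _ hi (α i))
      (fun L i ↦ ((((α i).val / (m / L)) : ℕ) : ZMod L)) (fun L hML i hiL ↦ hcast _ L hiL hML (α i))
      (fun L ⟨i, hiL⟩ hML hLM u ↦ hIH L (hiL ▸ level_dvd (α i)) hML hLM u)
    rw [sum_comp_eq_sum_card_mul (univ.filter fun i : Fin R ↦ m / m.gcd (α i).val = M)
      (fun i ↦ ((((α i).val / (m / M)) : ℕ) : ZMod M)) (fun u ↦ (χ u)⁻¹)] at key'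
    simp only [Finset.filter_filter] at key'
    have hconj : starRingEnd ℂ (∑ u : ZMod M, T u * χ u) = 0 := by
      rw [map_sum, ← key']
      refine Finset.sum_congr rfl fun u _ ↦ ?_
      rw [map_mul, hT, Complex.conj_natCast, char_inv_eq_conj]
    have := congrArg (starRingEnd ℂ) hconj
    rwa [starRingEnd_self_apply, map_zero] at this
  -- the refined counting leaves a prime of `M` without room, necessarily `p₁`
  have hbad : ∃ p ∈ M.primeFactors, ¬ (#(univ.filter fun u : ZMod M ↦ T u ≠ 0) + 1 < p ∨
      (p = M.minFac ∧ p * p ∣ M ∧ #(univ.filter fun u : ZMod M ↦ T u ≠ 0) < p)) := by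
    by_contra hgood
    push Not at hgood
    exact hnotev (even_of_oddNull' hM5 T hTu hTodd fun p hp ↦ by
      have := hgood p hp; tauto)
  obtain ⟨p, hpmem, hpbad⟩ := hbad
  have hp : p.Prime := Nat.prime_of_mem_primeFactors hpmem
  have hpM : p ∣ M := Nat.dvd_of_mem_primeFactors hpmem
  have hple : p ≤ #(univ.filter fun u : ZMod M ↦ T u ≠ 0) + 1 := by
    by_contra hlt; exact hpbad (Or.inl (by omega))
  have hpp : p = p₁ := by
    by_contra hne'
    have := hMbig p hpmem hne'
    omega
  subst hpp
  /- `M = p n`, `p ∤ n`, `n > 1`, primes of `n` ≥ `R + 3`, and the ℕ-valued dichotomy -/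
  have hsqM : ¬ p * p ∣ M := fun h' ↦ hsq (h'.trans hMm)
  obtain ⟨n, rfl⟩ := hpM
  have hn0 : n ≠ 0 := fun h0 ↦ hM0 (by rw [h0, mul_zero])
  haveI : NeZero n := ⟨hn0⟩
  have hpn : ¬ p ∣ n := fun hd ↦ hsqM (mul_dvd_mul_left p hd)
  have hc : Nat.Coprime p n := (Nat.Prime.coprime_iff_not_dvd hp).mpr hpn
  have hn1 : n ≠ 1 := by
    intro hn1
    subst hn1
    exact hnotev (even_of_oddNull_prime (by rw [mul_one]; exact hp) T hTu hTodd)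
  have hn5 : ∀ p' ∈ n.primeFactors, 5 ≤ p' := fun p' hp' ↦ hM5 p' (by
    rw [Nat.primeFactors_mul hp.ne_zero hn0]; exact mem_union_right _ hp')
  have hroom : ∀ p' ∈ n.primeFactors, #(univ.filter fun u : ZMod (p * n) ↦ T u ≠ 0) + 1 < p' := by
    intro p' hp'
    have hp'n := Nat.dvd_of_mem_primeFactors hp'
    have hne0 : p' ≠ p := fun he ↦ hpn (he ▸ hp'n)
    have := hMbig p' (by rw [Nat.primeFactors_mul hp.ne_zero hn0]; exact mem_union_right _ hp') hne0
    omega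
  rcases stub_fibre_of_boundary_nat p n hp hp₁5 hpn hn5 hc T hTnat hTu hTodd hroom with hev | ⟨b, hbu, hfib⟩
  · exact absurd hev hnotev
  refine ⟨n, hc, rfl, by omega, b, hbu, fun y ↦ ?_⟩
  have hne0 : cnt ((ZMod.chineseRemainder hc).symm ((y : ZMod p), b)) ≠ 0 := by
    have := hfib y
    simpa only [hT, Nat.cast_ne_zero] using this
  obtain ⟨i, hi⟩ := Finset.card_ne_zero.mp hne0
  rw [mem_filter] at hi
  exact ⟨i, hi.2.1, hi.2.2⟩

end TopLevelSingle

/-- **GS-L2a `stub_fibre_of_top_level_single`** (registered form of `fibre_of_top_level_single`). [cite: Aoki1983, Thm. A′ (§7), Prop. 2.2, Prop. 6.4] -/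
theorem stub_fibre_of_top_level_single : ∀ (p₁ R : ℕ), p₁.Prime → 5 ≤ p₁ → ∀ {m : ℕ} [NeZero m] {α : Fin R → ZMod m}, m.Coprime 6 → (∀ q ∈ m.primeFactors, q ≠ p₁ → R + 3 ≤ q) → ¬ p₁ * p₁ ∣ m → FermatCharacter.IsHodge α → ∀ {M : ℕ}, M ∣ m → (∃ v : ZMod M, #(univ.filter fun i : Fin R ↦ m / m.gcd (α i).val = M ∧ ((((α i).val / (m / M)) : ℕ) : ZMod M) = -v) ≠ #(univ.filter fun i : Fin R ↦ m / m.gcd (α i).val = M ∧ ((((α i).val / (m / M)) : ℕ) : ZMod M) = v)) → (∀ M' : ℕ, M' ∣ m → M ∣ M' → M' ≠ M → ∀ u : ZMod M', #(univ.filter fun i : Fin R ↦ m / m.gcd (α i).val = M' ∧ ((((α i).val / (m / M')) : ℕ) : ZMod M') = -u) = #(univ.filter fun i : Fin R ↦ m / m.gcd (α i).val = M' ∧ ((((α i).val / (m / M')) : ℕ) : ZMod M') = u)) → ∃ (n : ℕ) (hc : Nat.Coprime p₁ n), M = p₁ * n ∧ 1 < n ∧ ∃ b : ZMod n, IsUnit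 b ∧ ∀ y : (ZMod p₁)ˣ, ∃ i : Fin R, m / m.gcd (α i).val = p₁ * n ∧ ((((α i).val / (m / (p₁ * n))) : ℕ) : ZMod (p₁ * n)) = (ZMod.chineseRemainder hc).symm ((y : ZMod p₁), b) :=
  fun _ _ hp₁ hp₁5 _ _ _ hm6 hbig hsq h _ hMm hne hIH ↦ fibre_of_top_level_single hp₁ hp₁5 hm6 hbig hsq h hMm hne hIH

end PairedNull

end Summit.HodgeConjecture.HodgeConjecture.Theorems.CancelByAnyClaimLattice

end
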